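import Literature.NumberTheory.LFunctions.Zhang2022.Section12Eq1216EdgeExact
import Literature.NumberTheory.LFunctions.Zhang2022.RepairGapSection12Low1522Premise
import Literature.NumberTheory.LFunctions.Zhang2022.RepairGapSection12Top1522Premise
import HarnessLib

/-!
# Zhang (2022), rescue GAP/BED (D-0124 (3)(4)): **(12.16) AS PRINTED** (`Typed.Sec12C.Eq1216`) under the minimum premise
# `‖L(1,χ)‖ ≤ 𝓛⁻¹⁵` — UNCONDITIONAL

Topic `Literature/NumberTheory/LFunctions/Zhang2022` (Landau–Siegel audit tree; verdict-neutral).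
Y. Zhang, *Discrete mean estimates and the Landau–Siegel zero*, arXiv:2211.02515v1 (2022)
[Zhang2022LandauSiegel] — **an unrefereed manuscript under adjudication; nothing in this file asserts or
denies its Theorems 1–2, and nothing here is a claim about Landau–Siegel zeros. The programme SEARCHES and
TYPES; no claim about Landau–Siegel zeros, Theorems 1–2 of arXiv:2211.02515 or a repaired Margin232 until a
kernel theorem says so.**

The printed display (12.16) (p. 73, tex L3710): «`(1/2α)S₁(𝐚₁₅,𝐚₂₂) + (2/α)S₂(𝐚₁₅,𝐚₂₂) + (3/2α)S₃(𝐚₁₅,𝐚₂₂) = 𝔞(conj e₂* + ε/2)`»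
is the typed leaf `Typed.Sec12C.Eq1216 c′` AS PRINTED (slack `10⁻⁵𝔞/2`), a tree theorem (`eq1216_holds`) via
`Sec12D.eq1216_of_low1522_top1522Ex_shape` from the low range `Low1522` and the exact top range `Top1522Ex`. Both inputs are
now kernel under `‖L(1,χ)‖ ≤ 𝓛⁻¹⁵` (`Typed.Sec12C.low1522_pow15`, `RepairGapSection12Low1522Premise`;
`Typed.Sec12C.top1522Ex_pow15`, `RepairGapSection12Top1522Premise` p614734); Assumption (A) is only THREADED in the edge. This
file re-runs the edge VERBATIM with the guard text swapped (certificate / window functional / weight lemmas are the tree's):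

* `eq1216_pow15_of_low_of_topEx`, `eq1216_pow15_of_low_of_topEx_shape` — the two edge theorems with pow15 guards;
* **`eq1216_pow15` — the body of `Typed.Sec12C.Eq1216 c′` with its guard `AssumptionA D χ` replaced by `‖L(1,χ)‖ ≤ 𝓛⁻¹⁵`, for
  every `c′`, UNCONDITIONAL: the printed (12.16) holds for all large `D` and every real primitive `χ` with
  `‖L(1,χ)‖ ≤ (log D)^{−15}`** (same `ε`-form, same `10⁻⁵/2` slack as the typed leaf); `eq1216_of_assumptionAWith` — under
  `Repair.Bed.AssumptionAWith E` for every real `E ≥ 15` (at `E = 2022` the body of the tree theorem `eq1216_holds`, not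
  restated).

GAP reading (as-typed; row G-31, §12 layer): the first PRINTED DISPLAY of §12 kernel at (A)-exponent 15; its (A)-content is
Lemma 8.2 (leaf + core via U020 / line020), Lemma 8.4 (rel), Lemma 8.3 (hypothesis-free) — all through the Lemma 5.8 door.
Not re-keyed: (12.15), (12.17) (the other top/mid/low ranges `Eq126` / `Eq128` / `Eq1212` / `Mid1225` and Part I).
Theorems only; no definition, no named fact; nothing about (A) itself.

## References

* Y. Zhang, arXiv:2211.02515v1 (2022), §12 p. 73, (12.16); p. 68 (proof of Lemma 12.1).
  [cite: Zhang2022LandauSiegel, §12 (12.16) p.73]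
-/

noncomputable section

open Complex Real ComplexConjugate
open Literature.NumberTheory.LFunctions.Zhang2022
open Literature.NumberTheory.LFunctions.Zhang2022.Skeleton
open Literature.NumberTheory.LFunctions.Zhang2022.Typed.Sec12A
open Literature.NumberTheory.LFunctions.Zhang2022.Typed.Sec12C
open Literature.NumberTheory.LFunctions.Zhang2022.Numerics (wLin wStarExact J6 J7 ghj6 ghj7 e2starBarW E16x mem_E16x)
open Literature.Analysis.ValidatedNumerics.Numerics

namespace Literature.NumberTheory.LFunctions.Zhang2022.Sec12D

open Literature.NumberTheory.LFunctions.Zhang2022.Repair.Bed (AssumptionAWith)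

section Edge

variable (c' : ℝ)

/-- **(12.16) ⇐ low range `o(α)` + u049 second line with weights eventually within `10⁻⁵` of `wStarExact`, ALL GUARDS AT
`‖L(1,χ)‖ ≤ 𝓛⁻¹⁵`** (twin of `eq1216_of_low1522_of_topEx`, proof verbatim; budget `3.85·10⁻⁶ ≤ 5·10⁻⁶`).
[cite: Zhang2022LandauSiegel, §12 (12.16) p.73] -/
theorem eq1216_pow15_of_low_of_topEx
    (hLow : ∀ ε : ℝ, 0 < ε → ForAllLarge fun D _ χ => ‖χ.LFunction 1‖ ≤ 1 / Real.log D ^ 15 →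
          ∀ a15 : ℕ → ℂ, (∀ n, a15 n = χ (n : ZMod D) * vk13 D n) →
            ∀ j ∈ ({1, 2, 3} : Finset ℕ), ‖SjOn c' D j a15 (a22 χ) (rngBot D)‖ ≤ ε * alpha D)
    (w : ℕ → ℕ → ℝ → ℂ)
    (hw : ForAllLarge fun D _ _ => ∀ j ∈ ({1, 2, 3} : Finset ℕ), Continuous (w D j) ∧
      ∀ z ∈ Set.Icc (0.496 : ℝ) 0.5, ‖w D j z - wStarExact j z‖ ≤ 1e-5)
    (hTop : ∀ ε : ℝ, 0 < ε → ForAllLarge fun D _ χ => ‖χ.LFunction 1‖ ≤ 1 / Real.log D ^ 15 →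
      ∀ a15 : ℕ → ℂ, (∀ n, a15 n = χ (n : ZMod D) * vk13 D n) → ∀ j ∈ ({1, 2, 3} : Finset ℕ),
        ‖SjOn c' D j a15 (a22 χ) (rngTop D) -
            (frakA χ * iota3 / (0.504 * 0.498 * Real.log (bigP D)) *
                (∫ z in (0.496:ℝ)..0.498, ghj j 6 (0.498 - z) * w D j z) +
              frakA χ * iota4 / (0.504 * 0.5 * Real.log (bigP D)) *
                (∫ z in (0.496:ℝ)..0.5, ghj j 7 (0.5 - z) * w D j z))‖ ≤ ε * alpha D) :
    ∀ ε : ℝ, 0 < ε → ForAllLarge fun D _ χ => ‖χ.LFunction 1‖ ≤ 1 / Real.log D ^ 15 →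
      ∀ a15 : ℕ → ℂ, (∀ n, a15 n = χ (n : ZMod D) * vk13 D n) →
        ‖(1 / (2 * alpha D) * Sj c' D 1 a15 (a22 χ) + 2 / alpha D * Sj c' D 2 a15 (a22 χ) +
              3 / (2 * alpha D) * Sj c' D 3 a15 (a22 χ) : ℂ) - frakA χ * conj e2star‖ ≤
          frakA χ * (1e-5 / 2) + ε := by
  intro ε hε
  set η := ε / 8 with hη
  have hη0 : 0 < η := by positivity
  obtain ⟨D₀, hall⟩ := (((hLow η hη0).and (hTop η hη0)).and hw).and (forAllLarge_log_ge 4)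
  refine ⟨D₀, fun D _ χ hD hq hp hA a15 ha15 => ?_⟩
  obtain ⟨⟨⟨hLowD, hTopD⟩, hwD⟩, hlog4⟩ := hall D χ hD hq hp
  have hD1 : 1 ≤ Real.log D := by linarith
  have hα := alpha_pos_of_log (D := D) hD1
  have hAf := frakA_nonneg χ
  -- names
  set S : ℕ → ℂ := fun j => Sj c' D j a15 (a22 χ) with hS
  set B : ℕ → ℂ := fun j => SjOn c' D j a15 (a22 χ) (rngBot D) with hB
  set T : ℕ → ℂ := fun j => SjOn c' D j a15 (a22 χ) (rngTop D) with hT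
  set m : ℕ → ℂ := fun j => frakA χ * iota3 / (0.504 * 0.498 * Real.log (bigP D)) *
      (∫ z in (0.496:ℝ)..0.498, ghj j 6 (0.498 - z) * w D j z) +
    frakA χ * iota4 / (0.504 * 0.5 * Real.log (bigP D)) *
      (∫ z in (0.496:ℝ)..0.5, ghj j 7 (0.5 - z) * w D j z) with hm
  have hBj : ∀ j ∈ ({1, 2, 3} : Finset ℕ), ‖B j‖ ≤ η * alpha D := fun j hj => hLowD hA a15 ha15 j hj
  have hTj : ∀ j ∈ ({1, 2, 3} : Finset ℕ), ‖T j - m j‖ ≤ η * alpha D := fun j hj => hTopD hA a15 ha15 j hj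
  have hsplit : ∀ j, S j = B j + (T j - m j) + m j := fun j => by
    simp only [hS, hB, hT]; rw [Sj_a15_split c' χ hlog4 j a15]; ring
  have key : (1 / (2 * alpha D) * S 1 + 2 / alpha D * S 2 + 3 / (2 * alpha D) * S 3 : ℂ)
        - frakA χ * conj e2star
      = (1 / (2 * alpha D) * B 1 + 2 / alpha D * B 2 + 3 / (2 * alpha D) * B 3)
        + (1 / (2 * alpha D) * (T 1 - m 1) + 2 / alpha D * (T 2 - m 2) + 3 / (2 * alpha D) * (T 3 - m 3))
        + ((1 / (2 * alpha D) * m 1 + 2 / alpha D * m 2 + 3 / (2 * alpha D) * m 3) - frakA χ * conj e2star) := by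
    rw [hsplit 1, hsplit 2, hsplit 3]; ring
  have hmain : (1 / (2 * alpha D) * m 1 + 2 / alpha D * m 2 + 3 / (2 * alpha D) * m 3 : ℂ) =
      frakA χ * e2starBarW (w D) := weighted_window_eq χ hD1 (w D)
  have hwin : ‖e2starBarW (w D) - conj e2star‖ ≤ 1e-5 * 0.055 + 33 / 10 ^ 7 := by
    have h1 : ‖e2starBarW (w D) - e2starBarW wStarExact‖ ≤ 1e-5 * 0.055 :=
      e2starBarW_sub_le_of_close (by norm_num) (fun j hj => (hwD j hj).1)
        (fun j _ => by unfold Numerics.wStarExact; fun_prop) (fun j hj => (hwD j hj).2)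
    have h2 := norm_e2starBarW_exact_sub_lt
    have e : e2starBarW (w D) - conj e2star =
        (e2starBarW (w D) - e2starBarW wStarExact) + (e2starBarW wStarExact - conj e2star) := by ring
    rw [e]
    exact (norm_add_le _ _).trans (by linarith)
  have g1 : ‖(1 / (2 * alpha D) * B 1 + 2 / alpha D * B 2 + 3 / (2 * alpha D) * B 3 : ℂ)‖ ≤ 4 * η := by
    refine (norm_weighted_le hα (hBj 1 (by simp)) (hBj 2 (by simp)) (hBj 3 (by simp))).trans (le_of_eq ?_)
    field_simp; ring
  have g2 : ‖(1 / (2 * alpha D) * (T 1 - m 1) + 2 / alpha D * (T 2 - m 2) +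
      3 / (2 * alpha D) * (T 3 - m 3) : ℂ)‖ ≤ 4 * η := by
    refine (norm_weighted_le hα (hTj 1 (by simp)) (hTj 2 (by simp)) (hTj 3 (by simp))).trans (le_of_eq ?_)
    field_simp; ring
  have g3 : ‖(1 / (2 * alpha D) * m 1 + 2 / alpha D * m 2 + 3 / (2 * alpha D) * m 3 : ℂ)
      - frakA χ * conj e2star‖ ≤ frakA χ * (1e-5 * 0.055 + 33 / 10 ^ 7) := by
    rw [hmain, ← mul_sub, norm_mul, Complex.norm_real, Real.norm_of_nonneg hAf]
    exact mul_le_mul_of_nonneg_left hwin hAf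
  rw [key]
  calc ‖(1 / (2 * alpha D) * B 1 + 2 / alpha D * B 2 + 3 / (2 * alpha D) * B 3)
        + (1 / (2 * alpha D) * (T 1 - m 1) + 2 / alpha D * (T 2 - m 2) + 3 / (2 * alpha D) * (T 3 - m 3))
        + ((1 / (2 * alpha D) * m 1 + 2 / alpha D * m 2 + 3 / (2 * alpha D) * m 3) - frakA χ * conj e2star)‖
      ≤ ‖(1 / (2 * alpha D) * B 1 + 2 / alpha D * B 2 + 3 / (2 * alpha D) * B 3 : ℂ)‖
        + ‖(1 / (2 * alpha D) * (T 1 - m 1) + 2 / alpha D * (T 2 - m 2) + 3 / (2 * alpha D) * (T 3 - m 3) : ℂ)‖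
        + ‖(1 / (2 * alpha D) * m 1 + 2 / alpha D * m 2 + 3 / (2 * alpha D) * m 3 : ℂ)
            - frakA χ * conj e2star‖ := norm_add₃_le
    _ ≤ 4 * η + 4 * η + frakA χ * (1e-5 * 0.055 + 33 / 10 ^ 7) := by gcongr
    _ = frakA χ * (1e-5 * 0.055 + 33 / 10 ^ 7) + ε := by rw [hη]; ring
    _ ≤ frakA χ * (1e-5 / 2) + ε := by
        have : (1e-5 * 0.055 + 33 / 10 ^ 7 : ℝ) ≤ 1e-5 / 2 := by norm_num
        nlinarith

/-- **(12.16) from the pow15 `Low1522` and the u049 second line with the EXACT weight**, guards at `𝓛⁻¹⁵` (twin of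
`eq1216_of_low1522_top1522Ex_shape`). [cite: Zhang2022LandauSiegel, §12 (12.16) p.73] -/
theorem eq1216_pow15_of_low_of_topEx_shape
    (hLow : ∀ ε : ℝ, 0 < ε → ForAllLarge fun D _ χ => ‖χ.LFunction 1‖ ≤ 1 / Real.log D ^ 15 →
          ∀ a15 : ℕ → ℂ, (∀ n, a15 n = χ (n : ZMod D) * vk13 D n) →
            ∀ j ∈ ({1, 2, 3} : Finset ℕ), ‖SjOn c' D j a15 (a22 χ) (rngBot D)‖ ≤ ε * alpha D)
    (hTop : ∀ ε : ℝ, 0 < ε → ForAllLarge fun D _ χ => ‖χ.LFunction 1‖ ≤ 1 / Real.log D ^ 15 →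
      ∀ a15 : ℕ → ℂ, (∀ n, a15 n = χ (n : ZMod D) * vk13 D n) → ∀ j ∈ ({1, 2, 3} : Finset ℕ),
        ‖SjOn c' D j a15 (a22 χ) (rngTop D) -
            (frakA χ * iota3 / (0.504 * 0.498 * Real.log (bigP D)) *
                (∫ z in (0.496:ℝ)..0.498, ghj j 6 (0.498 - z) *
                  (((bigP D ^ z / P1pp D : ℝ) : ℂ) ^ (-beta6 D) *
                    (-1 + (beta6 D - betaJ c' D j) * (Real.log (bigP D ^ z / P1pp D) : ℂ)))) +
              frakA χ * iota4 / (0.504 * 0.5 * Real.log (bigP D)) *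
                (∫ z in (0.496:ℝ)..0.5, ghj j 7 (0.5 - z) *
                  (((bigP D ^ z / P1pp D : ℝ) : ℂ) ^ (-beta6 D) *
                    (-1 + (beta6 D - betaJ c' D j) * (Real.log (bigP D ^ z / P1pp D) : ℂ)))))‖ ≤
          ε * alpha D) :
    ∀ ε : ℝ, 0 < ε → ForAllLarge fun D _ χ => ‖χ.LFunction 1‖ ≤ 1 / Real.log D ^ 15 →
      ∀ a15 : ℕ → ℂ, (∀ n, a15 n = χ (n : ZMod D) * vk13 D n) →
        ‖(1 / (2 * alpha D) * Sj c' D 1 a15 (a22 χ) + 2 / alpha D * Sj c' D 2 a15 (a22 χ) +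
              3 / (2 * alpha D) * Sj c' D 3 a15 (a22 χ) : ℂ) - frakA χ * conj e2star‖ ≤
          frakA χ * (1e-5 / 2) + ε := by
  obtain ⟨D₁, hD₁⟩ := ell_large
    (1.02 * (780 * π) + (0.004 * (8 * |c'| * π ^ 2) + 520 * π * (3 / 2 + 8 * |c'| * π))) 1e-5
    (by positivity) (by norm_num)
  refine eq1216_pow15_of_low_of_topEx c' hLow
    (fun D j z => ((bigP D ^ z / P1pp D : ℝ) : ℂ) ^ (-beta6 D) *
      (-1 + (beta6 D - betaJ c' D j) * (Real.log (bigP D ^ z / P1pp D) : ℂ)))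
    ⟨D₁, fun D _ _ hD _ _ j hj => ?_⟩ hTop
  obtain ⟨hL1, hK⟩ := hD₁ D hD
  exact ⟨continuous_wStarEx_rpow c' hL1 j, wStarEx_sub_wStarExact_le c' hL1 hK j hj⟩

/-- **(12.16) AS PRINTED, UNDER THE MINIMUM PREMISE `‖L(1,χ)‖ ≤ 𝓛⁻¹⁵`, UNCONDITIONAL** — the body of `Typed.Sec12C.Eq1216 c′`
(«`(1/2α)S₁ + (2/α)S₂ + (3/2α)S₃ = 𝔞(conj e₂* + ε/2)`», p. 73 tex L3710, slack `10⁻⁵𝔞/2`) with its guard replaced by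
`‖L(1,χ)‖ ≤ 𝓛⁻¹⁵`, every `c′`: `eq1216_pow15_of_low_of_topEx_shape` at `low1522_pow15` and `top1522Ex_pow15` (the latter unfolded
by `main12u049intEx`, `frakwStarEx` exactly as in `eq1216_of_top1522Ex`). [cite: Zhang2022LandauSiegel, §12 (12.16) p.73] -/
theorem eq1216_pow15 :
    ∀ ε : ℝ, 0 < ε → ForAllLarge fun D _ χ => ‖χ.LFunction 1‖ ≤ 1 / Real.log D ^ 15 →
      ∀ a15 : ℕ → ℂ, (∀ n, a15 n = χ (n : ZMod D) * vk13 D n) →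
        ‖(1 / (2 * alpha D) * Sj c' D 1 a15 (a22 χ) + 2 / alpha D * Sj c' D 2 a15 (a22 χ) +
              3 / (2 * alpha D) * Sj c' D 3 a15 (a22 χ) : ℂ) - frakA χ * conj e2star‖ ≤
          frakA χ * (1e-5 / 2) + ε :=
  eq1216_pow15_of_low_of_topEx_shape c' (low1522_pow15 c')
    (by simpa only [main12u049intEx, frakwStarEx] using top1522Ex_pow15 c')

/-- **(12.16) as printed under `Repair.Bed.AssumptionAWith E`, every real `E ≥ 15`, UNCONDITIONAL** (transfer per `ε`; at the
printed `E = 2022` the body of `Typed.Sec12C.Eq1216 c′`, i.e. of the tree theorem `eq1216_holds`, not restated).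
[cite: Zhang2022LandauSiegel, §12 (12.16) p.73] -/
theorem eq1216_of_assumptionAWith {E : ℝ} (hE : 15 ≤ E) :
    ∀ ε : ℝ, 0 < ε → ForAllLarge fun D _ χ => AssumptionAWith E D χ →
      ∀ a15 : ℕ → ℂ, (∀ n, a15 n = χ (n : ZMod D) * vk13 D n) →
        ‖(1 / (2 * alpha D) * Sj c' D 1 a15 (a22 χ) + 2 / alpha D * Sj c' D 2 a15 (a22 χ) +
              3 / (2 * alpha D) * Sj c' D 3 a15 (a22 χ) : ℂ) - frakA χ * conj e2star‖ ≤
          frakA χ * (1e-5 / 2) + ε := by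
  intro ε hε
  exact Repair.Gap.forAllLarge_assumptionAWith_of_pow15 hE (eq1216_pow15 c' ε hε)

end Edge

end Literature.NumberTheory.LFunctions.Zhang2022.Sec12D

end
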